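import Summits.MatrixMultiplication.MatrixMultiplication.Theorems.SaturationLadderTwinClassCeiling
import HarnessLib

/-!
# SaturationLadder — no subcritical `Base(θ)` witness in the STAGE-2 twin class (the ceiling theorem)

Route `SaturationLadder` (sub-problem `MatrixMultiplication`), crux `SubexpSaturation`
(stmt-MatrixMultiplication-25909; `SubexpSaturation ↔ ∀ θ > 1, Base θ`, and by
`SaturationLadderTwinEndpoint.subexpSaturation_iff_base_cube_lt` only `1 < θ`, `θ³ < 3125/128` is open).
This file closes the cell's ceiling programme for the twin class
`SaturationLadderTwinExact.omegaRect_one_tw_exact` (BC9: «every rung a theorem AND the ceiling a theorem»):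

* §1  NORMALISATION (`mul_log_div`, `normY`, `normX`): the unnormalised defect inequalities of
  `SaturationLadderTwinDefect.defectY_of_class` / `defectX_of_class` (real atoms, general `n₆ > 0`,
  `B > 0`) divided by `n₆` are exactly the normalised inequalities `(Y*)`, `(X*)` consumed by
  `SaturationLadderTwinClassCeiling.mass_lower` / `ceiling_ineq` (the `log n₆` terms cancel by
  `n₁ + n₄ + n₅ = 2 n₆`).
* §2  THE CEILING THEOREM, normalised form (`no_subcritical_base`): for `1 < θ` with `log θ < c₂`
  (`c₂ = (5 log(5/4) + 3 log 2)/3 = log (3125/128)^{1/3}`) no constant `C` admits, for every `s < 1`,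
  normalised class data whose saturating pair has `t ≥ s` and `r ≤ C θ^{1/(1−s)}`:  `(C1)` forces
  `j + 1 ≥ 1/(16(1−s))`, and `(C2)` then gives `c₂ − 320/(j+1) ≤ (1−t) log r ≤ (1−s) log⁺C + log θ`.
* §3  THE CEILING THEOREM, class form (`no_subcritical_base_class`): the same with the data and the
  hypotheses VERBATIM those of `omegaRect_one_tw_exact` (natural counts `n₁,…,n₆`, level `j`, the two
  `shannonEntropy` constraints) and `θ³ < 3125/128`.  Hence: every `Base(θ)` certificate produced by the
  STAGE-2 twin method (`omegaRect_one_tw_exact` + padding `base_mono`) has `θ ≥ θ_c = (3125/128)^{1/3}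
  = 2.9009…`, while `SaturationLadderTwinEndpoint.base_of_cube_ge` produces one for every `θ ≥ θ_c`:
  `θ_c` is the EXACT ceiling of the method, strictly short of the crux (`θ → 1⁺`).  The open leaf
  `∀ θ ∈ (1, θ_c), Base θ` needs a different tensor family (cell tag IDEA-NEEDED); this is a statement
  about the method, not about `ω`.

No definitions, no named facts, no sorry. [cite: CoppersmithWinograd1990, §8]
[cite: AlmanDuanVassilevskaWilliamsXuXuZhou2025, §3.4]
-/

set_option linter.dupNamespace false
-- (single-conjunct summit: the namespace repeats `MatrixMultiplication`)

noncomputable section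

namespace Summit.MatrixMultiplication.MatrixMultiplication.Theorems.SaturationLadderTwinClassNoBase

open Literature.Computability.AlgebraicComplexity
open Summit.MatrixMultiplication.MatrixMultiplication.Theorems.SaturationLadderTwinDefect
  (mul_log_mul defectY_of_class defectX_of_class)
open Summit.MatrixMultiplication.MatrixMultiplication.Theorems.SaturationLadderTwinClassCeiling
  (mass_lower ceiling_ineq)

/-! ### §1  Normalisation `n₆ = 1` of the defect inequalities -/

/-- `x log x = n ((x/n) log(x/n)) + x log n` for `n > 0`, `x ≥ 0`. [folklore] -/
theorem mul_log_div {x n : ℝ} (hn : 0 < n) (hx : 0 ≤ x) :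
    x * Real.log x = n * (x / n * Real.log (x / n)) + x * Real.log n := by
  have h := mul_log_mul hn (div_nonneg hx hn.le)
  rw [mul_div_cancel₀ _ hn.ne'] at h
  rw [h, mul_add]
  congr 1
  rw [← mul_assoc, mul_div_cancel₀ _ hn.ne']

/-- Normalised `(Y*)`: the conclusion of `defectY_of_class` divided by `n₆`.
[cite: AlmanDuanVassilevskaWilliamsXuXuZhou2025, §3.4] -/
theorem normY {n₁ n₃ n₄ n₅ n₆ B : ℝ} (hn₆ : 0 < n₆) (hB : 0 < B) (h₃ : 0 ≤ n₃) (h₄ : 0 ≤ n₄)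
    (h₅ : 0 ≤ n₅) (hz : n₁ + n₄ + n₅ = 2 * n₆)
    (hU : (n₃ + n₅ + n₆) * Real.log (n₃ + n₅ + n₆) + n₄ * Real.log n₄
        - (2 * n₆) * Real.log (2 * n₆) - n₆ * Real.log n₆ ≤ (n₃ - n₁) * (Real.log (B * n₆) + 1)) :
    (n₃ / n₆ + n₅ / n₆ + 1) * Real.log (n₃ / n₆ + n₅ / n₆ + 1) + n₄ / n₆ * Real.log (n₄ / n₆)
        - 2 * Real.log 2 ≤ (n₃ / n₆ - n₁ / n₆) * (Real.log B + 1) := by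
  have e0 : n₃ / n₆ + n₅ / n₆ + 1 = (n₃ + n₅ + n₆) / n₆ := by
    field_simp
  rw [e0]
  have φ1 := mul_log_div hn₆ (show 0 ≤ n₃ + n₅ + n₆ by linarith)
  have φ4 := mul_log_div hn₆ h₄
  have e3 : (2 * n₆) * Real.log (2 * n₆) = n₆ * (2 * Real.log 2) + 2 * n₆ * Real.log n₆ := by
    rw [Real.log_mul two_ne_zero hn₆.ne']; ring
  have e4 : Real.log (B * n₆) = Real.log B + Real.log n₆ := Real.log_mul hB.ne' hn₆.ne'
  rw [φ1, φ4, e3, e4] at hU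
  refine le_of_mul_le_mul_left ?_ hn₆
  have e5 : n₆ * ((n₃ / n₆ - n₁ / n₆) * (Real.log B + 1)) = (n₃ - n₁) * (Real.log B + 1) := by
    field_simp
  rw [e5]
  have hzl : (n₁ + n₄ + n₅) * Real.log n₆ = 2 * n₆ * Real.log n₆ := by rw [hz]
  linarith [hU, hzl]

/-- Normalised `(X*)`: the conclusion of `defectX_of_class` divided by `n₆`.
[cite: AlmanDuanVassilevskaWilliamsXuXuZhou2025, §3.4] -/
theorem normX {n₁ n₃ n₄ n₅ n₆ B : ℝ} (hn₆ : 0 < n₆) (hB : 0 < B) (h₁ : 0 ≤ n₁) (h₃ : 0 ≤ n₃)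
    (h₅ : 0 ≤ n₅) (hz : n₁ + n₄ + n₅ = 2 * n₆)
    (hU : (n₁ + n₃) * Real.log (n₁ + n₃) + n₅ * Real.log n₅
        - (2 * n₆) * Real.log (2 * n₆) - n₆ * Real.log n₆ ≤ (n₃ - n₄ - n₆) * (Real.log (B * n₆) + 1)) :
    (n₁ / n₆ + n₃ / n₆) * Real.log (n₁ / n₆ + n₃ / n₆) + n₅ / n₆ * Real.log (n₅ / n₆)
        - 2 * Real.log 2 ≤ (n₃ / n₆ - n₄ / n₆ - 1) * (Real.log B + 1) := by
  have e0 : n₁ / n₆ + n₃ / n₆ = (n₁ + n₃) / n₆ := by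
    field_simp
  rw [e0]
  have φ1 := mul_log_div hn₆ (show 0 ≤ n₁ + n₃ by linarith)
  have φ5 := mul_log_div hn₆ h₅
  have e3 : (2 * n₆) * Real.log (2 * n₆) = n₆ * (2 * Real.log 2) + 2 * n₆ * Real.log n₆ := by
    rw [Real.log_mul two_ne_zero hn₆.ne']; ring
  have e4 : Real.log (B * n₆) = Real.log B + Real.log n₆ := Real.log_mul hB.ne' hn₆.ne'
  rw [φ1, φ5, e3, e4] at hU
  refine le_of_mul_le_mul_left ?_ hn₆
  have e5 : n₆ * ((n₃ / n₆ - n₄ / n₆ - 1) * (Real.log B + 1)) =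
      (n₃ - n₄ - n₆) * (Real.log B + 1) := by
    field_simp
  rw [e5]
  have hzl : (n₁ + n₄ + n₅) * Real.log n₆ = 2 * n₆ * Real.log n₆ := by rw [hz]
  linarith [hU, hzl]

/-! ### §2  The ceiling theorem, normalised form -/

/-- **The twin-class ceiling (normalised form).**  For `1 < θ` with `log θ < c₂ = log θ_c`
(`θ_c = (3125/128)^{1/3}`), no constant `C` admits, for every `s < 1`, normalised class data
(`n₆ = 1`; level `j`, atoms `n₁, n₃, n₄, n₅ ≥ 0` with `n₁ + n₄ + n₅ = 2` obeying the defect inequalities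
`(Y*)`, `(X*)` — consequences of the two entropy constraints of `omegaRect_one_tw_exact`, see
`defectY_of_class`, `defectX_of_class`) whose saturating pair has `t ≥ s` and `r ≤ C θ^{1/(1-s)}`.
Together with `SaturationLadderTwinEndpoint.base_of_cube_ge` (every `θ ≥ θ_c` IS reached in the class)
this makes `θ_c` the exact ceiling of the STAGE-2 twin method for the `Base` ladder of
`SubexpSaturation`.  Proof: `(C1)` forces `j + 1 ≥ 1/(16(1-s)) → ∞`, and `(C2)` then gives
`c₂ - o(1) ≤ (1-t) log r ≤ (1-s) log⁺ C + log θ`. [cite: CoppersmithWinograd1990, §8]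
[cite: AlmanDuanVassilevskaWilliamsXuXuZhou2025, §3.4] -/
theorem no_subcritical_base {θ C : ℝ} (hθ : 1 < θ)
    (hθc : Real.log θ < (5 * Real.log (5 / 4) + 3 * Real.log 2) / 3)
    (H : ∀ s : ℝ, 0 ≤ s → s < 1 → ∃ (j : ℕ) (n₁ n₃ n₄ n₅ : ℝ), 0 ≤ n₁ ∧ 0 ≤ n₃ ∧ 0 ≤ n₄ ∧ 0 ≤ n₅ ∧
      n₁ + n₄ + n₅ = 2 ∧
      (n₃ + n₅ + 1) * Real.log (n₃ + n₅ + 1) + n₄ * Real.log n₄ - 2 * Real.log 2 ≤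
        (n₃ - n₁) * (((j : ℝ) + 1) * Real.log 2 + 1) ∧
      (n₁ + n₃) * Real.log (n₁ + n₃) + n₅ * Real.log n₅ - 2 * Real.log 2 ≤
        (n₃ - n₄ - 1) * (((j : ℝ) + 1) * Real.log 2 + 1) ∧
      s ≤ (j : ℝ) * n₁ / (((j : ℝ) + 1) * n₃ + n₅) ∧
      (((j : ℝ) + 1) * ((2 : ℝ) ^ (j + 1) - n₃) + n₁ + n₄) / (((j : ℝ) + 1) * n₃ + n₅) ≤
        C * θ ^ (1 / (1 - s))) : False := by
  have hθ0 : 0 < θ := by linarith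
  have hlogθ : 0 < Real.log θ := Real.log_pos hθ
  set c₂ : ℝ := (5 * Real.log (5 / 4) + 3 * Real.log 2) / 3 with hc₂def
  set g : ℝ := c₂ - Real.log θ with hgdef
  have hg : 0 < g := by rw [hgdef]; linarith
  set C' : ℝ := max C 1 with hC'def
  have hC'1 : 1 ≤ C' := le_max_right _ _
  have hC'0 : 0 < C' := by linarith
  have hlogC' : 0 ≤ Real.log C' := Real.log_nonneg hC'1
  set K : ℝ := 5120 + Real.log C' with hKdef
  have hK0 : 0 < K := by rw [hKdef]; linarith
  set δ : ℝ := min (1 / 64) (g / (2 * K)) with hδdef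
  have hδ0 : 0 < δ := lt_min (by norm_num) (by positivity)
  have hδ1 : δ ≤ 1 / 64 := min_le_left _ _
  have hδ2 : δ * K ≤ g / 2 := by
    have := mul_le_mul_of_nonneg_right (min_le_right (1 / 64 : ℝ) (g / (2 * K))) hK0.le
    rw [← hδdef] at this
    calc δ * K ≤ g / (2 * K) * K := this
      _ = g / 2 := by field_simp
  obtain ⟨j, n₁, n₃, n₄, n₅, h₁, h₃, h₄, h₅, hz, hY, hX, hst, hr⟩ :=
    H (1 - δ) (by linarith) (by linarith)
  rw [sub_sub_cancel] at hr
  have hJ1 : (1 : ℝ) ≤ (j : ℝ) + 1 := by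
    have : (0 : ℝ) ≤ j := Nat.cast_nonneg j; linarith
  have hJ0 : (0 : ℝ) < (j : ℝ) + 1 := by linarith
  -- the denominator is positive and `j ≥ 1`
  have hDnn : 0 ≤ ((j : ℝ) + 1) * n₃ + n₅ := add_nonneg (mul_nonneg hJ0.le h₃) h₅
  have hD0 : 0 < ((j : ℝ) + 1) * n₃ + n₅ := by
    rcases eq_or_lt_of_le hDnn with h | h
    · rw [← h, div_zero] at hst; linarith
    · exact h
  have hj1 : 1 ≤ j := by
    rcases Nat.eq_zero_or_pos j with h0 | hpos
    · subst h0; simp at hst; linarith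
    · exact hpos
  -- regime `t ≥ 1/2`, mass, and `j ≥ 3`
  have hst' := hst
  rw [le_div_iff₀ hD0] at hst'
  have ht : ((j : ℝ) + 1) * n₃ + n₅ ≤ 2 * (j : ℝ) * n₁ := by
    have q0 : 0 ≤ (j : ℝ) * n₁ := mul_nonneg (Nat.cast_nonneg j) h₁
    have q1 := mul_le_mul_of_nonneg_right hδ1 hD0.le
    linarith only [hst', q0, q1]
  have hM := mass_lower j hj1 h₁ h₃ h₄ h₅ hz hY hX
  have hMD : ((j : ℝ) + 1) * (n₃ - n₁) + n₁ + n₅ ≤ δ * (((j : ℝ) + 1) * n₃ + n₅) := by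
    linarith only [hst']
  have hDδ : 1 ≤ 4 * δ * (((j : ℝ) + 1) * n₃ + n₅) := by linarith only [hM, hMD]
  have hDu : ((j : ℝ) + 1) * n₃ + n₅ ≤ 4 * ((j : ℝ) + 1) := by
    have q0 : ((j : ℝ) + 1) * n₃ ≤ ((j : ℝ) + 1) * (2 * n₁) := by linarith only [ht, h₁, h₅]
    have q1 : 0 ≤ ((j : ℝ) + 1) * n₄ := mul_nonneg hJ0.le h₄
    have q2 : 0 ≤ ((j : ℝ) + 1) * n₅ := mul_nonneg hJ0.le h₅
    have q3 : ((j : ℝ) + 1) * (2 * n₁) =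
        4 * ((j : ℝ) + 1) - 2 * (((j : ℝ) + 1) * n₄) - 2 * (((j : ℝ) + 1) * n₅) := by
      rw [show 2 * n₁ = 4 - 2 * n₄ - 2 * n₅ by linarith only [hz]]; ring
    have q4 : n₅ ≤ ((j : ℝ) + 1) * n₅ := le_mul_of_one_le_left h₅ hJ1
    linarith only [q0, q1, q2, q3, q4]
  have hJδ : 1 ≤ 16 * δ * ((j : ℝ) + 1) := by
    have := mul_le_mul_of_nonneg_left hDu (show 0 ≤ 4 * δ by linarith only [hδ0])
    linarith only [hDδ, this]
  have hJ4 : (4 : ℝ) ≤ (j : ℝ) + 1 := by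
    rcases le_or_gt 4 ((j : ℝ) + 1) with h | h
    · exact h
    · have := mul_lt_mul_of_pos_left h hδ0
      linarith only [hJδ, this, hδ1]
  have hj3 : 3 ≤ j := by
    have : (3 : ℝ) ≤ (j : ℝ) := by linarith only [hJ4]
    exact_mod_cast this
  -- the ceiling inequality and the size bound on `r`
  have hC := ceiling_ineq j hj3 h₁ h₃ h₄ h₅ hz hY hX ht
  have hB16 : (16 : ℝ) ≤ (2 : ℝ) ^ (j + 1) :=
    calc (16 : ℝ) = 2 ^ 4 := by norm_num
      _ ≤ 2 ^ (j + 1) := pow_le_pow_right₀ (by norm_num) (by omega)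
  have hn3u : n₃ ≤ 4 := by
    have q0 : ((j : ℝ) + 1) * n₃ ≤ ((j : ℝ) + 1) * (2 * n₁) := by linarith only [ht, h₁, h₅]
    have := le_of_mul_le_mul_left q0 hJ0
    linarith only [this, hz, h₄, h₅]
  have hr0 : 0 < (((j : ℝ) + 1) * ((2 : ℝ) ^ (j + 1) - n₃) + n₁ + n₄) /
      (((j : ℝ) + 1) * n₃ + n₅) := by
    apply div_pos _ hD0
    have := mul_nonneg hJ0.le (show 0 ≤ (2 : ℝ) ^ (j + 1) - n₃ - 1 by linarith only [hB16, hn3u])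
    linarith only [this, hJ0, h₁, h₄]
  have hr' : (((j : ℝ) + 1) * ((2 : ℝ) ^ (j + 1) - n₃) + n₁ + n₄) / (((j : ℝ) + 1) * n₃ + n₅) ≤
      C' * θ ^ (1 / δ) :=
    hr.trans (mul_le_mul_of_nonneg_right (le_max_left _ _) (Real.rpow_nonneg hθ0.le _))
  have hlogr : Real.log ((((j : ℝ) + 1) * ((2 : ℝ) ^ (j + 1) - n₃) + n₁ + n₄) /
      (((j : ℝ) + 1) * n₃ + n₅)) ≤ Real.log C' + 1 / δ * Real.log θ := by
    have := Real.log_le_log hr0 hr'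
    rwa [Real.log_mul hC'0.ne' (Real.rpow_pos_of_pos hθ0 _).ne', Real.log_rpow hθ0] at this
  -- `0 ≤ 1 - t ≤ δ`
  have h1t : 1 - (j : ℝ) * n₁ / (((j : ℝ) + 1) * n₃ + n₅) =
      (((j : ℝ) + 1) * (n₃ - n₁) + n₁ + n₅) / (((j : ℝ) + 1) * n₃ + n₅) := by
    rw [eq_div_iff hD0.ne', sub_mul, div_mul_cancel₀ _ hD0.ne']; ring
  have h1t0 : 0 ≤ 1 - (j : ℝ) * n₁ / (((j : ℝ) + 1) * n₃ + n₅) := by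
    rw [h1t]; exact div_nonneg (by linarith only [hM]) hD0.le
  have h1tδ : 1 - (j : ℝ) * n₁ / (((j : ℝ) + 1) * n₃ + n₅) ≤ δ := by linarith only [hst]
  -- combine
  have step : (1 - (j : ℝ) * n₁ / (((j : ℝ) + 1) * n₃ + n₅)) *
      Real.log ((((j : ℝ) + 1) * ((2 : ℝ) ^ (j + 1) - n₃) + n₁ + n₄) /
        (((j : ℝ) + 1) * n₃ + n₅)) ≤ δ * Real.log C' + Real.log θ := by
    have a1 := mul_le_mul_of_nonneg_left hlogr h1t0
    have a2 := mul_le_mul_of_nonneg_right h1tδ hlogC'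
    have a3 : (1 - (j : ℝ) * n₁ / (((j : ℝ) + 1) * n₃ + n₅)) * (1 / δ * Real.log θ) ≤
        Real.log θ := by
      have : (1 - (j : ℝ) * n₁ / (((j : ℝ) + 1) * n₃ + n₅)) * (1 / δ) ≤ 1 := by
        rw [mul_one_div, div_le_one hδ0]; exact h1tδ
      have := mul_le_mul_of_nonneg_right this hlogθ.le
      linarith only [this]
    linarith only [a1, a2, a3]
  have h320 : 320 / ((j : ℝ) + 1) ≤ 5120 * δ := by
    rw [div_le_iff₀ hJ0]; linarith only [hJδ]
  have hfin : g ≤ δ * K := by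
    rw [hgdef, hKdef]; linarith only [hC, step, h320, hc₂def]
  linarith only [hfin, hδ2, hg]


/-! ### §3  The ceiling theorem, class form -/

/-- `θ³ < 3125/128`, `θ > 0` ⇒ `3 log θ < 5 log(5/4) + 3 log 2` (`= log(3125/128)`). [folklore] -/
theorem three_log_lt_of_cube_lt {θ : ℝ} (hθ : 0 < θ) (hcube : θ ^ 3 < (3125 : ℝ) / 128) :
    3 * Real.log θ < 5 * Real.log (5 / 4) + 3 * Real.log 2 := by
  have h1 := Real.log_lt_log (pow_pos hθ 3) hcube
  rw [Real.log_pow, Real.log_div (by norm_num) (by norm_num)] at h1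
  have e5 : Real.log (3125 : ℝ) = 5 * Real.log (5 / 4) + 10 * Real.log 2 := by
    rw [show (3125 : ℝ) = (5 / 4) ^ 5 * 2 ^ 10 by norm_num, Real.log_mul (by norm_num) (by norm_num),
      Real.log_pow, Real.log_pow]
    push_cast; ring
  have e7 : Real.log (128 : ℝ) = 7 * Real.log 2 := by
    rw [show (128 : ℝ) = 2 ^ 7 by norm_num, Real.log_pow]; push_cast; ring
  rw [e5, e7] at h1; push_cast at h1; linarith

/-- **The twin-class ceiling (class form).**  Let `1 < θ`, `θ³ < 3125/128`.  There is no constant `C`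
such that for every `s < 1` some member of the STAGE-2 twin class — data `j, n₁, …, n₆ : ℕ` satisfying
VERBATIM the hypotheses of `SaturationLadderTwinExact.omegaRect_one_tw_exact` — has saturating pair
`(t, r) = (j n₁/((j+1) n₃ + n₅), ((j+1) n₂ + n₁ + n₄)/((j+1) n₃ + n₅))` with `s ≤ t` and
`r ≤ C θ^{1/(1−s)}`.  In words: the padded twin method (`omegaRect_one_tw_exact` + `base_mono`) cannot
certify `Base(θ)` for any `θ` below `θ_c = (3125/128)^{1/3}`, whereas `base_of_cube_ge` certifies it for
every `θ ≥ θ_c` — `θ_c` is the exact ceiling of the method (a theorem about the method, not about `ω`).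
Proof: normalise by `n₆` (§1) and apply `no_subcritical_base`.
[cite: CoppersmithWinograd1990, §8] [cite: AlmanDuanVassilevskaWilliamsXuXuZhou2025, §3.4] -/
theorem no_subcritical_base_class {θ C : ℝ} (hθ : 1 < θ) (hθc : θ ^ 3 < (3125 : ℝ) / 128)
    (H : ∀ s : ℝ, 0 ≤ s → s < 1 → ∃ (j n₁ n₂ n₃ n₄ n₅ n₆ : ℕ), 0 < n₆ ∧ n₁ + n₄ + n₅ = 2 * n₆ ∧
      n₂ + n₃ = 2 ^ (j + 1) * n₆ ∧ 0 < (j + 1) * n₃ + n₅ ∧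
      shannonEntropy ![((n₁ : ℝ) + n₄ + n₅) / (n₁ + n₂ + n₃ + n₄ + n₅ + n₆ : ℕ),
          ((n₂ : ℝ) + n₃) / (n₁ + n₂ + n₃ + n₄ + n₅ + n₆ : ℕ),
          (n₆ : ℝ) / (n₁ + n₂ + n₃ + n₄ + n₅ + n₆ : ℕ)] ≤
        shannonEntropy ![((n₂ : ℝ) + n₄ + n₆) / (n₁ + n₂ + n₃ + n₄ + n₅ + n₆ : ℕ),
          ((n₁ : ℝ) + n₃) / (n₁ + n₂ + n₃ + n₄ + n₅ + n₆ : ℕ),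
          (n₅ : ℝ) / (n₁ + n₂ + n₃ + n₄ + n₅ + n₆ : ℕ)] ∧
      shannonEntropy ![((n₁ : ℝ) + n₄ + n₅) / (n₁ + n₂ + n₃ + n₄ + n₅ + n₆ : ℕ),
          ((n₂ : ℝ) + n₃) / (n₁ + n₂ + n₃ + n₄ + n₅ + n₆ : ℕ),
          (n₆ : ℝ) / (n₁ + n₂ + n₃ + n₄ + n₅ + n₆ : ℕ)] ≤
        shannonEntropy ![((n₃ : ℝ) + n₅ + n₆) / (n₁ + n₂ + n₃ + n₄ + n₅ + n₆ : ℕ),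
          ((n₁ : ℝ) + n₂) / (n₁ + n₂ + n₃ + n₄ + n₅ + n₆ : ℕ),
          (n₄ : ℝ) / (n₁ + n₂ + n₃ + n₄ + n₅ + n₆ : ℕ)] ∧
      s ≤ ((j : ℝ) * n₁) / (((j : ℝ) + 1) * n₃ + n₅) ∧
      (((j : ℝ) + 1) * n₂ + n₁ + n₄) / (((j : ℝ) + 1) * n₃ + n₅) ≤ C * θ ^ (1 / (1 - s))) :
    False := by
  have hθ0 : 0 < θ := by linarith
  have hθc' : Real.log θ < (5 * Real.log (5 / 4) + 3 * Real.log 2) / 3 := by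
    have := three_log_lt_of_cube_lt hθ0 hθc; linarith
  refine no_subcritical_base (C := C) hθ hθc' ?_
  intro s hs0 hs1
  obtain ⟨j, n₁, n₂, n₃, n₄, n₅, n₆, hn₆, hz₁, hz₂, -, hX, hY, hst, hr⟩ := H s hs0 hs1
  have hn₆' : (0 : ℝ) < n₆ := by exact_mod_cast hn₆
  have hn6ne : (n₆ : ℝ) ≠ 0 := hn₆'.ne'
  have hz₁' : (n₁ : ℝ) + n₄ + n₅ = 2 * n₆ := by exact_mod_cast hz₁
  have hz₂' : (n₂ : ℝ) + n₃ = (2 : ℝ) ^ (j + 1) * n₆ := by exact_mod_cast hz₂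
  have hB : (0 : ℝ) < (2 : ℝ) ^ (j + 1) := by positivity
  push_cast at hX hY
  have hUY := defectY_of_class hB hn₆' (Nat.cast_nonneg n₁) (Nat.cast_nonneg n₂) hz₁' hz₂' hY
  have hUX := defectX_of_class hB hn₆' (Nat.cast_nonneg n₂) (Nat.cast_nonneg n₄) hz₁' hz₂' hX
  have hYn := normY hn₆' hB (Nat.cast_nonneg n₃) (Nat.cast_nonneg n₄) (Nat.cast_nonneg n₅) hz₁' hUY
  have hXn := normX hn₆' hB (Nat.cast_nonneg n₁) (Nat.cast_nonneg n₃) (Nat.cast_nonneg n₅) hz₁' hUX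
  rw [Real.log_pow] at hYn hXn
  push_cast at hYn hXn
  have ed : ((j : ℝ) + 1) * ((n₃ : ℝ) / n₆) + (n₅ : ℝ) / n₆ = (((j : ℝ) + 1) * n₃ + n₅) / n₆ := by
    rw [add_div, mul_div_assoc]
  have hn₂ : (n₂ : ℝ) = (2 : ℝ) ^ (j + 1) * n₆ - n₃ := by linarith
  refine ⟨j, n₁ / n₆, n₃ / n₆, n₄ / n₆, n₅ / n₆, by positivity, by positivity, by positivity,
    by positivity, ?_, hYn, hXn, ?_, ?_⟩
  · rw [← add_div, ← add_div, div_eq_iff hn6ne]; linarith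
  · have et : (j : ℝ) * ((n₁ : ℝ) / n₆) / (((j : ℝ) + 1) * ((n₃ : ℝ) / n₆) + (n₅ : ℝ) / n₆) =
        (j : ℝ) * n₁ / (((j : ℝ) + 1) * n₃ + n₅) := by
      rw [ed, ← mul_div_assoc, div_div_div_cancel_right₀ hn6ne]
    rw [et]; exact hst
  · have en : ((j : ℝ) + 1) * ((2 : ℝ) ^ (j + 1) - (n₃ : ℝ) / n₆) + (n₁ : ℝ) / n₆ + (n₄ : ℝ) / n₆ =
        (((j : ℝ) + 1) * n₂ + n₁ + n₄) / n₆ := by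
      rw [hn₂, eq_div_iff hn6ne]
      field_simp
    rw [en, ed, div_div_div_cancel_right₀ hn6ne]; exact hr

end Summit.MatrixMultiplication.MatrixMultiplication.Theorems.SaturationLadderTwinClassNoBase
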